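import Literature.Analysis.FluidPDE.EnergyToolkit
import Literature.Analysis.FluidPDE.SobolevWholeSpace
import HarnessLib

/-!
# The vorticity energy method for classical Navier–Stokes solutions, I:
# coordinates, the weighted div–curl inequality, and the differentiated vorticity equation

Analysis/FluidPDE support file, the third of five files discharging
`Literature.Analysis.FluidPDE.tao2011_hasBoundedSobolevNormsOn_of_memSobolevX` (Tao 2011, Cor. 4.3 + Thm. 5.4 (iv),
homogeneous case, classical solutions) by the classical energy method for the vorticity
equation (`CoordDerivatives` → `EnergyToolkit` → `NSVorticityEnergy` → `NSVorticitySlice` →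
`NSEnstrophyPersistence`). This file contains the pointwise-in-time ingredients that involve
the equations, on `ℝ^ι` for a general finite index type `ι`:

* **Vector fields and classical solutions in coordinates**: components of `Dv`, `(v · ∇)v`,
  `Δv`, `∇p`, `div v` in terms of the coordinate partials `∂ₗ` of `CoordDerivatives`; the
  momentum equation of `IsClassicalNSSolutionOn S ν 0 u p` componentwise
  (`momentum_comp`: `∂ₜuᵢ + ∑ⱼ uⱼ∂ⱼuᵢ = ν ∑ⱼ ∂ⱼ∂ⱼuᵢ − ∂ᵢp`) and `∑ᵢ ∂ᵢuᵢ = 0`.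
* **Integration by parts in a coordinate direction** against compactly supported weights
  (`integral_mul_pderiv_eq_neg`, from Mathlib's
  `integral_mul_fderiv_eq_neg_fderiv_mul_of_integrable`) and integrability of `φʲ h` for
  continuous `h` and continuous compactly supported `φ`.
* **The weighted div–curl inequality** (`integral_pow_four_mul_levelSq_succ_le`): for a smooth
  divergence-free field `v`, a smooth compactly supported weight `0 ≤ φ` with `|∂ₗφ| ≤ c`, and
  every `m`,
  `∫ φ⁴ |∇^{m+1} v|² ≤ ∫ φ⁴ |∇ᵐ Ω|² + 16 c² (card ι) ∫ φ² |∇ᵐ v|²`,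
  `Ω_{ki} = ∂ₖvᵢ − ∂ᵢvₖ`, from the pointwise identity
  `∑_{k,i} (∂ₖwᵢ)² = ½ ∑_{k,i} (∂ₖwᵢ − ∂ᵢwₖ)² + ∑ᵢ ∂ᵢ(∑ₖ wₖ∂ₖwᵢ)` for the divergence-free fields
  `w = ∂^β v`, integration by parts of the divergence against `φ⁴`, and Young's inequality.
  This is the localised form of the whole-space identity `‖∇v‖_{L²} = ‖∇ × v‖_{L²}` for
  divergence-free fields (Doering–Gibbon 1995, §6.1, (6.1.5)–(6.1.6)); the cutoff is needed
  because no decay of the higher derivatives is assumed.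
* **The differentiated vorticity equation** (`vorticity_transport`): for an unforced classical
  solution, `W = ∂^β Ω_{ki}(u)` satisfies
  `∂ₜW − ν ∑ⱼ ∂ⱼ∂ⱼW + ∑ⱼ uⱼ∂ⱼW = −∑ⱼ (rem^{k::β}_{ij} − rem^{i::β}_{kj})`,
  `rem^γ_{ij} = ∂^γ(uⱼ∂ⱼuᵢ) − uⱼ∂^γ∂ⱼuᵢ` — the curl eliminates the pressure
  (`∂ₖ∂^β∂ᵢp = ∂ᵢ∂^β∂ₖp`) and the mixed partials `∂ₜ∂^β∂ₖ = ∂^β∂ₖ∂ₜ` commute by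
  `EnergyToolkit` — together with the **forcing bound** (`abs_vorticity_forcing_le`)
  `|∂ₜW − ν ∑ⱼ ∂ⱼ∂ⱼW + ∑ⱼ uⱼ∂ⱼW| ≤ 2 (card ι) 2^{|β|+1} ∑_{a=1}^{|β|+1} |∇ᵃu| |∇^{|β|+2−a}u|`
  (Leibniz remainder bound of `CoordDerivatives`; every forcing term is a product `∇ᵃu ∇ᵇu`
  with `a + b = |β| + 2`, `a, b ≥ 1`).

The vorticity formulation is the standard device for estimates free of the pressure
(Majda–Bertozzi 2002, §1.4, the vorticity equation (1.32)–(1.33); the `H^m` energy method of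
§3.2, Prop. 3.7, eq. (3.58)); all statements here are elementary calculus identities or
inequalities for smooth functions and are tagged folklore.

## Mathlib search

Mathlib (this pin) has no vorticity/curl in coordinates, no Navier–Stokes notions (these are the
tree's `Fluid.IsClassicalNSSolutionOn`, `Fluid.convect`, `Fluid.divergence`, `Fluid.gradient`,
`Laplacian`), and no div–curl lemma; the sibling `TaoEnstrophyLocalisationProofs` proves the
*unweighted* whole-space div–curl bounds for `L²` fields via `Fluid.curl` on `ℝ³`, whereas the
energy method below needs the *weighted* coordinate form at every derivative level on `ℝ^ι`.
No new definitions.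

## References

* A. J. Majda, A. L. Bertozzi, *Vorticity and Incompressible Flow*, CUP (2002)
  (`MajdaBertozzi2002`), §1.4, vorticity equation (1.32)–(1.33) (held copy p. 19); §3.2,
  Prop. 3.7 "The `H^m` energy estimate", eq. (3.58) (held copy p. 93). [folklore]
* C. R. Doering, J. D. Gibbon, *Applied Analysis of the Navier–Stokes Equations*, CUP (1995)
  (`DoeringGibbon1995`), §6.1, eqs. (6.1.5)–(6.1.6), p. 96 (`∫|∇u|² = ∫|ω|²` for divergence-free
  `u`).
* T. Tao, *Localisation and compactness properties of the Navier–Stokes global regularity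
  problem*, Anal. PDE 6 (2013), 25–107; arXiv:1108.1165 (`Tao2011`), Cor. 4.3 and Thm. 5.4 (iv)
  (the fact being discharged; Tao's printed proof goes through mild solutions instead).
-/

noncomputable section

open MeasureTheory Set Function Filter Topology InnerProductSpace
open scoped ENNReal NNReal ContDiff BigOperators Laplacian RealInnerProductSpace

namespace Literature.Analysis.FluidPDE

/-! ## Vector fields on `ℝ^ι` in coordinates -/

section Components

variable {ι : Type*} [Fintype ι] [DecidableEq ι]

/-- Expansion of a vector of `ℝ^ι` in the standard basis. [folklore] -/
theorem euclidean_eq_sum_smul_stdVec (w : EuclideanSpace ℝ ι) : w = ∑ j, w j • (stdVec j : EuclideanSpace ℝ ι) := by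
  conv_lhs => rw [← (EuclideanSpace.basisFun ι ℝ).sum_repr w]
  simp [stdVec, EuclideanSpace.basisFun_apply]

/-- `Dg(x) w = ∑ⱼ wⱼ ∂ⱼ g (x)` for a scalar `g`. [folklore] -/
theorem fderiv_apply_eq_sum_mul_pderiv (g : EuclideanSpace ℝ ι → ℝ) (x w : EuclideanSpace ℝ ι) :
    fderiv ℝ g x w = ∑ j, w j * pderiv j g x := by
  conv_lhs => rw [euclidean_eq_sum_smul_stdVec w]
  simp [map_sum, map_smul, pderiv_apply]

/-- **The convective term in coordinates**: `((v·∇)v)ᵢ = ∑ⱼ vⱼ ∂ⱼ vᵢ`. [folklore] -/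
theorem convect_apply_comp {v w : EuclideanSpace ℝ ι → EuclideanSpace ℝ ι} {x : EuclideanSpace ℝ ι} (hv : DifferentiableAt ℝ v x) (i : ι) :
    convect w v x i = ∑ j, w x j * pderiv j (fun y => v y i) x := by
  rw [convect_apply, euclidean_fderiv_apply_comp hv, fderiv_apply_eq_sum_mul_pderiv]

/-- **The Laplacian in coordinates**: `(Δv)ᵢ = ∑ⱼ ∂ⱼ∂ⱼ vᵢ` for `C²` fields. [folklore] -/
theorem laplacian_apply_comp {v : EuclideanSpace ℝ ι → EuclideanSpace ℝ ι} (hv : ContDiff ℝ 2 v) (x : EuclideanSpace ℝ ι) (i : ι) :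
    (Δ v) x i = ∑ j, pderiv j (pderiv j fun y => v y i) x := by
  rw [laplacian_eq_sum_fderiv_fderiv (EuclideanSpace.basisFun ι ℝ) hv x]
  simp only [WithLp.ofLp_sum, Finset.sum_apply]
  refine Finset.sum_congr rfl fun j _ => ?_
  have hb : (EuclideanSpace.basisFun ι ℝ) j = (stdVec j : EuclideanSpace ℝ ι) := by
    simp [stdVec, EuclideanSpace.basisFun_apply]
  rw [hb]
  have hd : DifferentiableAt ℝ (fun y => fderiv ℝ v y (stdVec j)) x :=
    (((hv.fderiv_right (m := 1) le_rfl).clm_apply contDiff_const).differentiable one_ne_zero) x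
  change (fderiv ℝ (fun y => fderiv ℝ v y (stdVec j)) x (stdVec j)) i = _
  rw [euclidean_fderiv_apply_comp hd]
  have hfun : (fun y => fderiv ℝ v y (stdVec j) i) = pderiv j fun y => v y i := by
    funext y
    rw [euclidean_fderiv_apply_comp ((hv.differentiable (by norm_num)) y)]
    rfl
  rw [hfun]
  rfl

/-- **The gradient in coordinates**: `(∇p)ᵢ = ∂ᵢ p`. [folklore] -/
theorem gradient_apply_comp (p : EuclideanSpace ℝ ι → ℝ) (x : EuclideanSpace ℝ ι) (i : ι) : gradient p x i = pderiv i p x := by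
  have h : gradient p x i = ⟪gradient p x, (stdVec i : EuclideanSpace ℝ ι)⟫ := by
    rw [stdVec, EuclideanSpace.inner_single_right]
    simp
  rw [h, inner_gradient_left, pderiv_apply]

end Components

/-! ## Classical Navier–Stokes solutions in coordinates -/

section NSCoord

variable {ι : Type*} [Fintype ι] [DecidableEq ι]
variable {S : Set ℝ} {ν : ℝ} {f u : ℝ → EuclideanSpace ℝ ι → EuclideanSpace ℝ ι}
  {p : ℝ → EuclideanSpace ℝ ι → ℝ}


/-- **The momentum equation in coordinates** for a classical solution on a time set of unique
differentiability: `∂ₜuᵢ + ∑ⱼ uⱼ ∂ⱼuᵢ = ν ∑ⱼ ∂ⱼ∂ⱼuᵢ − ∂ᵢp + fᵢ` (Fefferman, (1)). [folklore] -/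
theorem IsClassicalNSSolutionOn.momentum_comp (h : IsClassicalNSSolutionOn S ν f u p)
    (hS : UniqueDiffOn ℝ S) {t : ℝ} (ht : t ∈ S) (x : EuclideanSpace ℝ ι) (i : ι) :
    FluidPDE.timeDerivWithin S (fun s y => u s y i) t x +
        ∑ j, u t x j * pderiv j (fun y => u t y i) x =
      ν * ∑ j, pderiv j (pderiv j fun y => u t y i) x - pderiv i (p t) x + f t x i := by
  have hm := congrArg (fun w : (EuclideanSpace ℝ ι) => w i) (h.momentum t ht x)
  have hdiff : DifferentiableAt ℝ (u t) x :=
    ((h.contDiff_velocity ht).differentiable (by simp)) x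
  simp only [PiLp.add_apply, PiLp.sub_apply, PiLp.smul_apply, smul_eq_mul] at hm
  rw [convect_apply_comp hdiff, laplacian_apply_comp ((h.contDiff_velocity ht).of_le (WithTop.coe_le_coe.2 le_top)),
    gradient_apply_comp, ← h.smooth_velocity.timeDerivWithin_euclidean_comp hS i ht x] at hm
  exact hm

/-- **Incompressibility in coordinates**: `∑ᵢ ∂ᵢuᵢ = 0` (Fefferman, (2)). [folklore] -/
theorem IsClassicalNSSolutionOn.sum_pderiv_comp_eq_zero (h : IsClassicalNSSolutionOn S ν f u p)
    {t : ℝ} (ht : t ∈ S) (x : EuclideanSpace ℝ ι) : ∑ i, pderiv i (fun y => u t y i) x = 0 := by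
  rw [← divergence_eq_sum_pderiv (((h.contDiff_velocity ht).differentiable (by simp)) x)]
  exact h.divFree t ht x

omit [DecidableEq ι] in
/-- The components `(t, x) ↦ uᵢ(t, x)` of the velocity are jointly smooth. [folklore] -/
theorem IsClassicalNSSolutionOn.isSmoothSpaceTimeOn_comp (h : IsClassicalNSSolutionOn S ν f u p)
    (i : ι) : IsSmoothSpaceTimeOn S (fun t x => u t x i) :=
  h.smooth_velocity.euclidean_comp i

omit [DecidableEq ι] in
/-- The slices `uᵢ(t, ·)` are smooth. [folklore] -/
theorem IsClassicalNSSolutionOn.contDiff_comp (h : IsClassicalNSSolutionOn S ν f u p) {t : ℝ}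
    (ht : t ∈ S) (i : ι) : ContDiff ℝ ∞ (fun y => u t y i) :=
  (h.isSmoothSpaceTimeOn_comp i).contDiff_slice ht

end NSCoord

/-! ## Integration by parts and integrability of localised integrands on `ℝ^ι` -/

section IBP

variable {ι : Type*} [Fintype ι] [DecidableEq ι]


/-- **Integration by parts in a coordinate direction**: `∫ ψ ∂ₗ g = −∫ ∂ₗ ψ g` for `C¹`
functions with `ψ` compactly supported (Mathlib
`integral_mul_fderiv_eq_neg_fderiv_mul_of_integrable`). [folklore] -/
theorem integral_mul_pderiv_eq_neg {ψ g : EuclideanSpace ℝ ι → ℝ} (hψ : ContDiff ℝ 1 ψ)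
    (hψc : HasCompactSupport ψ) (hg : ContDiff ℝ 1 g) (l : ι) :
    ∫ x, ψ x * pderiv l g x = -∫ x, pderiv l ψ x * g x := by
  simp only [pderiv_apply]
  refine integral_mul_fderiv_eq_neg_fderiv_mul_of_integrable ?_ ?_ ?_
    (fun x _ => (hψ.differentiable one_ne_zero x)) (fun x _ => (hg.differentiable one_ne_zero x))
  · exact (((hψ.continuous_fderiv one_ne_zero).clm_apply continuous_const).mul hg.continuous)
      |>.integrable_of_hasCompactSupport ((hψc.fderiv_apply (𝕜 := ℝ) (stdVec l)).mul_right)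
  · exact (hψ.continuous.mul ((hg.continuous_fderiv one_ne_zero).clm_apply continuous_const))
      |>.integrable_of_hasCompactSupport hψc.mul_right
  · exact (hψ.continuous.mul hg.continuous).integrable_of_hasCompactSupport hψc.mul_right

/-- Powers `φʲ`, `j ≥ 1`, of a compactly supported function are compactly supported. [folklore] -/
theorem hasCompactSupport_pow {X : Type*} [TopologicalSpace X] {φ : X → ℝ}
    (hc : HasCompactSupport φ) {j : ℕ} (hj : j ≠ 0) : HasCompactSupport fun x => φ x ^ j :=
  hc.comp_left (g := fun r : ℝ => r ^ j) (zero_pow hj)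

omit [DecidableEq ι] in
/-- `x ↦ φ(x)ʲ h(x)` is integrable for continuous `h` and continuous compactly supported `φ`,
`j ≥ 1`. [folklore] -/
theorem integrable_pow_mul_of_continuous {φ h : EuclideanSpace ℝ ι → ℝ} (hφ : Continuous φ)
    (hc : HasCompactSupport φ) (hh : Continuous h) {j : ℕ} (hj : j ≠ 0) :
    Integrable (fun x => φ x ^ j * h x) := by
  exact ((hφ.pow j).mul hh).integrable_of_hasCompactSupport (hasCompactSupport_pow hc hj).mul_right

/-- `∂ₗ (φ⁴) = 4 φ³ ∂ₗ φ`. [folklore] -/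
theorem pderiv_pow_four {φ : EuclideanSpace ℝ ι → ℝ} (hφ : Differentiable ℝ φ) (l : ι) (x : EuclideanSpace ℝ ι) :
    pderiv l (fun y => φ y ^ 4) x = 4 * φ x ^ 3 * pderiv l φ x := by
  have := congrFun (pderiv_pow hφ 3 l) x
  rw [this]
  norm_num

end IBP

/-! ## The weighted div–curl inequality -/

section DivCurl

variable {ι : Type*} [Fintype ι] [DecidableEq ι]


variable {v : EuclideanSpace ℝ ι → EuclideanSpace ℝ ι} {φ : EuclideanSpace ℝ ι → ℝ}

/-- **The cross term is a divergence**: for a smooth divergence-free field `w`,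
`∑_{k,i} ∂ₖwᵢ ∂ᵢwₖ = ∑ᵢ ∂ᵢ (∑ₖ wₖ ∂ₖwᵢ)` pointwise (`∑ᵢ ∂ᵢ∂ₖwᵢ = ∂ₖ ∑ᵢ ∂ᵢwᵢ = 0`). [folklore] -/
theorem sum_pderiv_mul_pderiv_eq_sum_pderiv {w : ι → EuclideanSpace ℝ ι → ℝ} (hw : ∀ i, ContDiff ℝ ∞ (w i))
    (hdiv : ∀ x, ∑ i, pderiv i (w i) x = 0) (x : EuclideanSpace ℝ ι) :
    ∑ k, ∑ i, pderiv k (w i) x * pderiv i (w k) x =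
      ∑ i, pderiv i (fun y => ∑ k, w k y * pderiv k (w i) y) x := by
  have hd : ∀ i, Differentiable ℝ (w i) := fun i => (hw i).differentiable (by simp)
  have hdp : ∀ k i, Differentiable ℝ (pderiv k (w i)) := fun k i =>
    (contDiff_pderiv (hw i) k).differentiable (by simp)
  have h1 : ∀ i, pderiv i (fun y => ∑ k, w k y * pderiv k (w i) y) x =
      ∑ k, (pderiv i (w k) x * pderiv k (w i) x + w k x * pderiv i (pderiv k (w i)) x) := by
    intro i
    rw [pderiv_sum (f := fun k y => w k y * pderiv k (w i) y) _ (fun k _ => (hd k).mul (hdp k i))]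
    simp only
    refine Finset.sum_congr rfl fun k _ => ?_
    rw [pderiv_mul (hd k) (hdp k i)]
  simp only [h1, Finset.sum_add_distrib]
  have h2 : ∑ i, ∑ k, w k x * pderiv i (pderiv k (w i)) x = 0 := by
    rw [Finset.sum_comm]
    refine Finset.sum_eq_zero fun k _ => ?_
    rw [← Finset.mul_sum]
    have h3 : ∑ i, pderiv i (pderiv k (w i)) x = pderiv k (fun y => ∑ i, pderiv i (w i) y) x := by
      rw [pderiv_sum (f := fun i y => pderiv i (w i) y) _ (fun i _ => hdp i i)]
      simp only
      refine Finset.sum_congr rfl fun i _ => ?_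
      rw [pderiv_comm (hw i)]
    rw [h3, show (fun y => ∑ i, pderiv i (w i) y) = fun _ => (0 : ℝ) from funext hdiv,
      pderiv_const]
    simp
  rw [h2, add_zero, Finset.sum_comm]

/-- **Pointwise Young inequality for the cross term**: with `|∂ᵢφ| ≤ c` and `0 ≤ φ`,
`−∂ᵢ(φ⁴) wₖ ∂ₖwᵢ ≤ ½ φ⁴ (∂ₖwᵢ)² + 8 c² φ² wₖ²`. [folklore] -/
theorem neg_pderiv_pow_four_mul_le {c : ℝ} (hφ : Differentiable ℝ φ) (hφ0 : ∀ x, 0 ≤ φ x)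
    (hc : ∀ l x, |pderiv l φ x| ≤ c) (a b : ℝ) (i : ι) (x : EuclideanSpace ℝ ι) :
    -(pderiv i (fun y => φ y ^ 4) x * (b * a)) ≤
      2⁻¹ * (φ x ^ 4 * a ^ 2) + 8 * c ^ 2 * (φ x ^ 2 * b ^ 2) := by
  rw [pderiv_pow_four hφ]
  have h0 := hφ0 x
  have h1 := hc i x
  have hc0 : 0 ≤ c := (abs_nonneg _).trans h1
  have key : |4 * φ x ^ 3 * pderiv i φ x * (b * a)| ≤ 4 * c * (φ x ^ 2 * |a|) * (φ x * |b|) := by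
    rw [abs_mul, abs_mul, abs_mul, abs_mul, abs_of_nonneg (by norm_num : (0:ℝ) ≤ 4),
      abs_of_nonneg (pow_nonneg h0 3)]
    have : φ x ^ 3 = φ x ^ 2 * φ x := by ring
    rw [this]
    have hp : 0 ≤ φ x ^ 2 * φ x := mul_nonneg (sq_nonneg _) h0
    nlinarith [abs_nonneg a, abs_nonneg b, mul_nonneg hp (mul_nonneg (abs_nonneg b) (abs_nonneg a)),
      mul_le_mul_of_nonneg_left h1 (mul_nonneg (mul_nonneg hp (abs_nonneg b)) (abs_nonneg a))]
  have hsq : 4 * c * (φ x ^ 2 * |a|) * (φ x * |b|) ≤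
      2⁻¹ * (φ x ^ 4 * a ^ 2) + 8 * c ^ 2 * (φ x ^ 2 * b ^ 2) := by
    have e1 : φ x ^ 4 * a ^ 2 = (φ x ^ 2 * |a|) ^ 2 := by rw [mul_pow, sq_abs]; ring
    have e2 : φ x ^ 2 * b ^ 2 = (φ x * |b|) ^ 2 := by rw [mul_pow, sq_abs]
    rw [e1, e2]
    nlinarith [sq_nonneg (φ x ^ 2 * |a| - 4 * c * (φ x * |b|))]
  exact (neg_le_abs _).trans (key.trans hsq)

/-- **The weighted div–curl inequality for one derivative word.** For a smooth divergence-free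
field with components `wᵢ` and a smooth compactly supported weight `0 ≤ φ` with `|∂φ| ≤ c`:
`∫ φ⁴ ∑_{k,i} (∂ₖwᵢ)² ≤ ∫ φ⁴ ∑_{k,i} (∂ₖwᵢ − ∂ᵢwₖ)² + 16 c² (card ι) ∫ φ² ∑ₖ wₖ²`
(pointwise `∑ (∂ₖwᵢ)² = ½ ∑ (∂ₖwᵢ − ∂ᵢwₖ)² + ∑ᵢ ∂ᵢ(wₖ∂ₖwᵢ)`, integration by parts of the
divergence against `φ⁴`, and the pointwise Young inequality). [folklore] -/
theorem integral_pow_four_mul_sum_sq_pderiv_le {w : ι → EuclideanSpace ℝ ι → ℝ} (hw : ∀ i, ContDiff ℝ ∞ (w i))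
    (hdiv : ∀ x, ∑ i, pderiv i (w i) x = 0) (hφ : ContDiff ℝ ∞ φ) (hφc : HasCompactSupport φ)
    (hφ0 : ∀ x, 0 ≤ φ x) {c : ℝ} (hc : ∀ l x, |pderiv l φ x| ≤ c) :
    ∫ x, φ x ^ 4 * ∑ k, ∑ i, pderiv k (w i) x ^ 2 ≤
      (∫ x, φ x ^ 4 * ∑ k, ∑ i, (pderiv k (w i) x - pderiv i (w k) x) ^ 2) +
        16 * c ^ 2 * Fintype.card ι * ∫ x, φ x ^ 2 * ∑ k, w k x ^ 2 := by
  have hφd : Differentiable ℝ φ := hφ.differentiable (by simp)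
  have hφcont : Continuous φ := hφ.continuous
  have hd : ∀ i, Differentiable ℝ (w i) := fun i => (hw i).differentiable (by simp)
  have cw : ∀ i, Continuous (w i) := fun i => (hw i).continuous
  have cpw : ∀ k i, Continuous (pderiv k (w i)) := fun k i => continuous_pderiv (hw i) (by simp) k
  -- the three integrands
  set L : EuclideanSpace ℝ ι → ℝ := fun x => ∑ k, ∑ i, pderiv k (w i) x ^ 2 with hL
  set V : EuclideanSpace ℝ ι → ℝ := fun x => ∑ k, ∑ i, (pderiv k (w i) x - pderiv i (w k) x) ^ 2 with hV
  set L₀ : EuclideanSpace ℝ ι → ℝ := fun x => ∑ k, w k x ^ 2 with hL₀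
  set g : ι → EuclideanSpace ℝ ι → ℝ := fun i y => ∑ k, w k y * pderiv k (w i) y with hg
  have cL : Continuous L := continuous_finsetSum _ fun k _ => continuous_finsetSum _ fun i _ =>
    (cpw k i).pow 2
  have cV : Continuous V := continuous_finsetSum _ fun k _ => continuous_finsetSum _ fun i _ =>
    ((cpw k i).sub (cpw i k)).pow 2
  have cL₀ : Continuous L₀ := continuous_finsetSum _ fun k _ => (cw k).pow 2
  have hgs : ∀ i, ContDiff ℝ ∞ (g i) := fun i =>
    ContDiff.sum fun k _ => (hw k).mul (contDiff_pderiv (hw i) k)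
  -- pointwise: `φ⁴ L = ½ φ⁴ V + φ⁴ ∑ᵢ ∂ᵢ gᵢ`
  have hpt : ∀ x, φ x ^ 4 * L x = 2⁻¹ * (φ x ^ 4 * V x) + φ x ^ 4 * ∑ i, pderiv i (g i) x := by
    intro x
    rw [hL, hV]
    simp only
    rw [sum_sq_eq_half_sum_sq_sub_add (fun k i => pderiv k (w i) x),
      sum_pderiv_mul_pderiv_eq_sum_pderiv hw hdiv x]
    ring
  -- integrate
  have iL : Integrable fun x => φ x ^ 4 * L x := integrable_pow_mul_of_continuous hφcont hφc cL
    (by norm_num)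
  have iV : Integrable fun x => φ x ^ 4 * V x := integrable_pow_mul_of_continuous hφcont hφc cV
    (by norm_num)
  have iL₀ : Integrable fun x => φ x ^ 2 * L₀ x := integrable_pow_mul_of_continuous hφcont hφc cL₀
    (by norm_num)
  have iG : ∀ i, Integrable fun x => φ x ^ 4 * pderiv i (g i) x := fun i =>
    integrable_pow_mul_of_continuous hφcont hφc (continuous_pderiv (hgs i) (by simp) i)
      (by norm_num)
  have hφ4 : ContDiff ℝ 1 fun y => φ y ^ 4 := (hφ.pow 4).of_le (by exact_mod_cast le_top)
  have hφ4c : HasCompactSupport fun y => φ y ^ 4 := hasCompactSupport_pow hφc (by norm_num)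
  -- integration by parts of the divergence term, and its bound
  have hIBP : ∀ i, ∫ x, φ x ^ 4 * pderiv i (g i) x = -∫ x, pderiv i (fun y => φ y ^ 4) x * g i x :=
    fun i => integral_mul_pderiv_eq_neg hφ4 hφ4c ((hgs i).of_le (by exact_mod_cast le_top)) i
  have cdφ4 : ∀ i, Continuous (pderiv i fun y => φ y ^ 4) := fun i =>
    continuous_pderiv hφ4 one_ne_zero i
  have hbound : ∀ i, -∫ x, pderiv i (fun y => φ y ^ 4) x * g i x ≤
      ∫ x, ∑ k, (2⁻¹ * (φ x ^ 4 * pderiv k (w i) x ^ 2) + 8 * c ^ 2 * (φ x ^ 2 * w k x ^ 2)) := by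
    intro i
    rw [← integral_neg]
    refine integral_mono ?_ ?_ fun x => ?_
    · refine (((cdφ4 i).mul (hgs i).continuous).integrable_of_hasCompactSupport ?_).neg
      exact (hφ4c.fderiv_apply (𝕜 := ℝ) (stdVec i)).mul_right
    · exact integrable_finsetSum _ fun k _ =>
        ((integrable_pow_mul_of_continuous hφcont hφc ((cpw k i).pow 2) (by norm_num)).const_mul
          _).add
        ((integrable_pow_mul_of_continuous hφcont hφc ((cw k).pow 2) (by norm_num)).const_mul _)
    · simp only [hg, Finset.mul_sum, ← Finset.sum_neg_distrib]
      exact Finset.sum_le_sum fun k _ =>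
        neg_pderiv_pow_four_mul_le hφd hφ0 hc (pderiv k (w i) x) (w k x) i x
  -- pointwise regrouping of the bound
  have hregroup : ∀ x, ∑ i, ∑ k, (2⁻¹ * (φ x ^ 4 * pderiv k (w i) x ^ 2) +
      8 * c ^ 2 * (φ x ^ 2 * w k x ^ 2)) =
      2⁻¹ * (φ x ^ 4 * L x) + 8 * c ^ 2 * Fintype.card ι * (φ x ^ 2 * L₀ x) := by
    intro x
    have hA : ∑ i, ∑ k, 2⁻¹ * (φ x ^ 4 * pderiv k (w i) x ^ 2) = 2⁻¹ * (φ x ^ 4 * L x) := by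
      rw [hL]
      simp only [Finset.mul_sum]
      rw [Finset.sum_comm]
    have hB : ∑ _i : ι, ∑ k, 8 * c ^ 2 * (φ x ^ 2 * w k x ^ 2) =
        8 * c ^ 2 * Fintype.card ι * (φ x ^ 2 * L₀ x) := by
      rw [Finset.sum_const, Finset.card_univ, nsmul_eq_mul, hL₀]
      simp only [Finset.mul_sum]
      exact Finset.sum_congr rfl fun k _ => by ring
    simp only [Finset.sum_add_distrib]
    rw [hA, hB]
  -- assemble
  have hsum : ∑ i, ∫ x, φ x ^ 4 * pderiv i (g i) x ≤
      2⁻¹ * (∫ x, φ x ^ 4 * L x) + 8 * c ^ 2 * Fintype.card ι * ∫ x, φ x ^ 2 * L₀ x := by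
    have hint : ∀ i, Integrable fun x => ∑ k, (2⁻¹ * (φ x ^ 4 * pderiv k (w i) x ^ 2) +
        8 * c ^ 2 * (φ x ^ 2 * w k x ^ 2)) := fun i =>
      integrable_finsetSum _ fun k _ =>
        ((integrable_pow_mul_of_continuous hφcont hφc ((cpw k i).pow 2) (by norm_num)).const_mul
          _).add
        ((integrable_pow_mul_of_continuous hφcont hφc ((cw k).pow 2) (by norm_num)).const_mul _)
    calc ∑ i, ∫ x, φ x ^ 4 * pderiv i (g i) x
        ≤ ∑ i, ∫ x, ∑ k, (2⁻¹ * (φ x ^ 4 * pderiv k (w i) x ^ 2) +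
            8 * c ^ 2 * (φ x ^ 2 * w k x ^ 2)) :=
          Finset.sum_le_sum fun i _ => (hIBP i).le.trans (hbound i)
      _ = ∫ x, ∑ i, ∑ k, (2⁻¹ * (φ x ^ 4 * pderiv k (w i) x ^ 2) +
            8 * c ^ 2 * (φ x ^ 2 * w k x ^ 2)) := (integral_finsetSum _ fun i _ => hint i).symm
      _ = ∫ x, (2⁻¹ * (φ x ^ 4 * L x) + 8 * c ^ 2 * Fintype.card ι * (φ x ^ 2 * L₀ x)) :=
          integral_congr_ae (Eventually.of_forall hregroup)
      _ = 2⁻¹ * (∫ x, φ x ^ 4 * L x) + 8 * c ^ 2 * Fintype.card ι * ∫ x, φ x ^ 2 * L₀ x := by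
          rw [integral_add (iL.const_mul _) (iL₀.const_mul _), integral_const_mul, integral_const_mul]
  have iS : Integrable fun x => φ x ^ 4 * ∑ i, pderiv i (g i) x :=
    integrable_pow_mul_of_continuous hφcont hφc
      (continuous_finsetSum _ fun i _ => continuous_pderiv (hgs i) (by simp) i) (by norm_num)
  have hmain : ∫ x, φ x ^ 4 * L x =
      2⁻¹ * (∫ x, φ x ^ 4 * V x) + ∑ i, ∫ x, φ x ^ 4 * pderiv i (g i) x := by
    rw [integral_congr_ae (Eventually.of_forall hpt), integral_add (iV.const_mul _) iS,
      integral_const_mul]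
    congr 1
    rw [← integral_finsetSum _ fun i _ => iG i]
    exact integral_congr_ae (Eventually.of_forall fun x => by simp [Finset.mul_sum])
  have hL0 : 0 ≤ ∫ x, φ x ^ 4 * L x := integral_nonneg fun x => mul_nonneg (pow_nonneg (hφ0 x) 4)
    (Finset.sum_nonneg fun _ _ => Finset.sum_nonneg fun _ _ => sq_nonneg _)
  change ∫ x, φ x ^ 4 * L x ≤ (∫ x, φ x ^ 4 * V x) + 16 * c ^ 2 * Fintype.card ι * ∫ x, φ x ^ 2 * L₀ x
  nlinarith [hmain, hsum, hL0]

/-- **The weighted div–curl inequality**: for a smooth divergence-free vector field `v` on `ℝ^ι`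
and a smooth compactly supported weight `0 ≤ φ` with `|∂φ| ≤ c`, at every derivative level `m`,
`∫ φ⁴ |∇^{m+1} v|² ≤ ∫ φ⁴ |∇ᵐ Ω|² + 16 c² (card ι) ∫ φ² |∇ᵐ v|²`
(the previous lemma applied to the divergence-free fields `w = ∂^β v`, `|β| = m`, and summed
over `β`; the whole-space identity `‖∇v‖ = ‖curl v‖` for divergence-free fields is
Doering–Gibbon 1995, §6.1). [folklore] -/
theorem integral_pow_four_mul_levelSq_succ_le (hv : ContDiff ℝ ∞ v)
    (hdiv : ∀ x, ∑ i, pderiv i (fun y => v y i) x = 0) (hφ : ContDiff ℝ ∞ φ)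
    (hφc : HasCompactSupport φ) (hφ0 : ∀ x, 0 ≤ φ x) {c : ℝ} (hc : ∀ l x, |pderiv l φ x| ≤ c)
    (m : ℕ) :
    ∫ x, φ x ^ 4 * levelSq (m + 1) v x ≤
      (∫ x, φ x ^ 4 * vortSq m v x) +
        16 * c ^ 2 * Fintype.card ι * ∫ x, φ x ^ 2 * levelSq m v x := by
  have hφcont : Continuous φ := hφ.continuous
  -- the fields `w^β_i = ∂^β vᵢ`
  set w : (Fin m → ι) → ι → EuclideanSpace ℝ ι → ℝ := fun β i => ipderiv β fun y => v y i with hw_def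
  have hw : ∀ β i, ContDiff ℝ ∞ (w β i) := fun β i => contDiff_ipderiv (contDiff_comp_of_contDiff hv i) β
  have hwdiv : ∀ β x, ∑ i, pderiv i (w β i) x = 0 := fun β x => sum_pderiv_ipderiv_eq_zero hv hdiv β x
  have hβ := fun β => integral_pow_four_mul_sum_sq_pderiv_le (hw β) (hwdiv β) hφ hφc hφ0 hc
  -- continuity of the word integrands
  have cpw : ∀ β k i, Continuous (pderiv k (w β i)) := fun β k i => continuous_pderiv (hw β i) (by simp) k
  have c1 : ∀ β : Fin m → ι, Continuous fun x => ∑ k, ∑ i, pderiv k (w β i) x ^ 2 := fun β =>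
    continuous_finsetSum _ fun k _ => continuous_finsetSum _ fun i _ => (cpw β k i).pow 2
  have c2 : ∀ β : Fin m → ι, Continuous fun x => ∑ k, ∑ i, (pderiv k (w β i) x - pderiv i (w β k) x) ^ 2 :=
    fun β => continuous_finsetSum _ fun k _ => continuous_finsetSum _ fun i _ =>
      ((cpw β k i).sub (cpw β i k)).pow 2
  have c3 : ∀ β : Fin m → ι, Continuous fun x => ∑ k, w β k x ^ 2 := fun β =>
    continuous_finsetSum _ fun k _ => (hw β k).continuous.pow 2
  -- rewrite the three integrals as sums over words
  have e1 : ∫ x, φ x ^ 4 * levelSq (m + 1) v x =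
      ∑ β : Fin m → ι, ∫ x, φ x ^ 4 * ∑ k, ∑ i, pderiv k (w β i) x ^ 2 := by
    rw [← integral_finsetSum _ fun β _ =>
      integrable_pow_mul_of_continuous hφcont hφc (c1 β) (by norm_num)]
    refine integral_congr_ae (Eventually.of_forall fun x => ?_)
    simp only [levelSq_succ_eq, Finset.mul_sum, hw_def]
  have e2 : ∫ x, φ x ^ 4 * vortSq m v x =
      ∑ β : Fin m → ι, ∫ x, φ x ^ 4 * ∑ k, ∑ i, (pderiv k (w β i) x - pderiv i (w β k) x) ^ 2 := by
    rw [← integral_finsetSum _ fun β _ =>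
      integrable_pow_mul_of_continuous hφcont hφc (c2 β) (by norm_num)]
    refine integral_congr_ae (Eventually.of_forall fun x => ?_)
    simp only [vortSq_eq hv, Finset.mul_sum, hw_def]
  have e3 : ∫ x, φ x ^ 2 * levelSq m v x = ∑ β : Fin m → ι, ∫ x, φ x ^ 2 * ∑ k, w β k x ^ 2 := by
    rw [← integral_finsetSum _ fun β _ =>
      integrable_pow_mul_of_continuous hφcont hφc (c3 β) (by norm_num)]
    refine integral_congr_ae (Eventually.of_forall fun x => ?_)
    simp only [levelSq, dnormSq, Finset.mul_sum, hw_def]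
    rw [Finset.sum_comm]
  rw [e1, e2, e3, Finset.mul_sum, ← Finset.sum_add_distrib]
  exact Finset.sum_le_sum fun β _ => hβ β

end DivCurl

/-! ## The vorticity equation for `∂^β Ω_{ki}` and the forcing bound -/

section Vorticity

variable {ι : Type*} [Fintype ι] [DecidableEq ι]
variable {S : Set ℝ} {ν : ℝ} {u : ℝ → EuclideanSpace ℝ ι → EuclideanSpace ℝ ι}
  {p : ℝ → EuclideanSpace ℝ ι → ℝ}


/-- The unforced momentum equation solved for `∂ₜuᵢ`, as an identity of functions of `x`:
`∂ₜuᵢ = ν ∑ⱼ ∂ⱼ∂ⱼuᵢ − ∂ᵢp − ∑ⱼ uⱼ∂ⱼuᵢ`. [folklore] -/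
theorem IsClassicalNSSolutionOn.timeDerivWithin_comp_eq (h : IsClassicalNSSolutionOn S ν 0 u p)
    (hS : UniqueDiffOn ℝ S) {t : ℝ} (ht : t ∈ S) (i : ι) :
    FluidPDE.timeDerivWithin S (fun s y => u s y i) t = fun x =>
      ν * ∑ j, pderiv j (pderiv j fun y => u t y i) x - pderiv i (p t) x -
        ∑ j, u t x j * pderiv j (fun y => u t y i) x := by
  funext x
  have hm := h.momentum_comp hS ht x i
  simp only [Pi.zero_apply, PiLp.zero_apply, add_zero] at hm
  linarith

/-- The word derivative `∂^β Ω_{ki}` of the vorticity of the slices, written with the two words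
`k :: β`, `i :: β`: `∂^β Ω_{ki}(u(s)) = ∂^{k::β} uᵢ(s) − ∂^{i::β} uₖ(s)` for `s ∈ S`. [folklore] -/
theorem IsClassicalNSSolutionOn.ipderiv_vortComp_eq (h : IsClassicalNSSolutionOn S ν 0 u p)
    {s : ℝ} (hs : s ∈ S) {n : ℕ} (β : Fin n → ι) (k i : ι) (y : EuclideanSpace ℝ ι) :
    ipderiv β (vortComp (u s) k i) y =
      ipderiv (Fin.cons k β : Fin (n + 1) → ι) (fun z => u s z i) y -
        ipderiv (Fin.cons i β : Fin (n + 1) → ι) (fun z => u s z k) y := by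
  rw [ipderiv_vortComp (h.contDiff_velocity hs), ipderiv_cons, ipderiv_cons]

/-- **The vorticity transport identity.** For an unforced classical solution on a time set `S`
of unique differentiability contained in the closure of its interior, `t ∈ S`, a word `β` and
indices `k, i`, the field `W = ∂^β Ω_{ki}` satisfies
`∂ₜW − ν ∑ⱼ ∂ⱼ∂ⱼW + ∑ⱼ uⱼ ∂ⱼW = −∑ⱼ (rem^{k::β}_{ij} − rem^{i::β}_{kj})` with the Leibniz
remainders `rem^{γ}_{ij} = ∂^γ(uⱼ ∂ⱼuᵢ) − uⱼ ∂^γ∂ⱼuᵢ`; the pressure drops out because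
`∂ₖ∂^β∂ᵢp = ∂ᵢ∂^β∂ₖp` (the vorticity equation, Majda–Bertozzi (1.33), differentiated `|β|`
times). [folklore] -/
theorem IsClassicalNSSolutionOn.vorticity_transport (h : IsClassicalNSSolutionOn S ν 0 u p)
    (hS : UniqueDiffOn ℝ S) (hcl : S ⊆ closure (interior S)) {t : ℝ} (ht : t ∈ S) (x : EuclideanSpace ℝ ι)
    {n : ℕ} (β : Fin n → ι) (k i : ι) :
    FluidPDE.timeDerivWithin S (fun s y => ipderiv β (vortComp (u s) k i) y) t x -
        ν * ∑ j, pderiv j (pderiv j (ipderiv β (vortComp (u t) k i))) x +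
        ∑ j, u t x j * pderiv j (ipderiv β (vortComp (u t) k i)) x =
      -∑ j, ((ipderiv (Fin.cons k β : Fin (n + 1) → ι) (fun y => u t y j * pderiv j (fun z => u t z i) y) x -
              u t x j * ipderiv (Fin.cons k β : Fin (n + 1) → ι) (pderiv j fun z => u t z i) x) -
            (ipderiv (Fin.cons i β : Fin (n + 1) → ι) (fun y => u t y j * pderiv j (fun z => u t z k) y) x -
              u t x j * ipderiv (Fin.cons i β : Fin (n + 1) → ι) (pderiv j fun z => u t z k) x)) := by
  -- smoothness of all the players
  have hu : ∀ {s}, s ∈ S → ContDiff ℝ ∞ (u s) := fun hs => h.contDiff_velocity hs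
  have hU : ∀ j, ContDiff ℝ ∞ fun y => u t y j := fun j => contDiff_comp_of_contDiff (hu ht) j
  have hP : ContDiff ℝ ∞ (p t) := h.contDiff_pressure ht
  have hdU : ∀ j l, ContDiff ℝ ∞ (pderiv l fun y => u t y j) := fun j l => contDiff_pderiv (hU j) l
  set γk : Fin (n + 1) → ι := Fin.cons k β with hγk
  set γi : Fin (n + 1) → ι := Fin.cons i β with hγi
  -- (A1) the time derivative through the words
  have hfield : ∀ s ∈ S, ∀ y, ipderiv β (vortComp (u s) k i) y =
      ipderiv γk (fun z => u s z i) y - ipderiv γi (fun z => u s z k) y :=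
    fun s hs y => h.ipderiv_vortComp_eq hs β k i y
  have hsm : ∀ (γ : Fin (n + 1) → ι) (j : ι),
      IsSmoothSpaceTimeOn S (fun s y => ipderiv γ (fun z => u s z j) y) := fun γ j =>
    (h.isSmoothSpaceTimeOn_comp j).ipderiv_slice hS γ
  have hT : ∀ (γ : Fin (n + 1) → ι) (j : ι),
      FluidPDE.timeDerivWithin S (fun s y => ipderiv γ (fun z => u s z j) y) t x =
        ipderiv γ (FluidPDE.timeDerivWithin S (fun s y => u s y j) t) x := fun γ j =>
    (h.isSmoothSpaceTimeOn_comp j).timeDerivWithin_ipderiv_slice hS hcl γ ht x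
  have hA1 : FluidPDE.timeDerivWithin S (fun s y => ipderiv β (vortComp (u s) k i) y) t x =
      ipderiv γk (FluidPDE.timeDerivWithin S (fun s y => u s y i) t) x -
        ipderiv γi (FluidPDE.timeDerivWithin S (fun s y => u s y k) t) x := by
    rw [timeDerivWithin_congr_on hfield ht x, (hsm γk i).timeDerivWithin_fun_sub (hsm γi k) hS ht x,
      hT, hT]
  -- (A2)-(A3) expand `∂^γ (∂ₜ u_j)`
  have hA3 : ∀ (γ : Fin (n + 1) → ι) (j : ι),
      ipderiv γ (FluidPDE.timeDerivWithin S (fun s y => u s y j) t) x =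
        ν * ∑ l, pderiv l (pderiv l (ipderiv γ fun y => u t y j)) x -
          ipderiv γ (pderiv j (p t)) x -
          ∑ l, ipderiv γ (fun y => u t y l * pderiv l (fun z => u t z j) y) x := by
    intro γ j
    rw [h.timeDerivWithin_comp_eq hS ht j]
    have hAf : ContDiff ℝ ∞ fun y => ν * ∑ l, pderiv l (pderiv l fun z => u t z j) y :=
      contDiff_const.mul (ContDiff.sum fun l _ => contDiff_pderiv (hdU j l) l)
    have hBf : ContDiff ℝ ∞ (pderiv j (p t)) := contDiff_pderiv hP j
    have hCf : ContDiff ℝ ∞ fun y => ∑ l, u t y l * pderiv l (fun z => u t z j) y :=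
      ContDiff.sum fun l _ => (hU l).mul (hdU j l)
    have e1 := ipderiv_sub (hAf.sub hBf) hCf γ
    have e2 := ipderiv_sub hAf hBf γ
    have e3 := ipderiv_const_mul (f := fun y => ∑ l, pderiv l (pderiv l fun z => u t z j) y)
      (ContDiff.sum fun l _ => contDiff_pderiv (hdU j l) l) ν γ
    have e4 := ipderiv_finset_sum Finset.univ (f := fun l y => pderiv l (pderiv l fun z => u t z j) y)
      (fun l => contDiff_pderiv (hdU j l) l) γ
    have e5 := ipderiv_finset_sum Finset.univ
      (f := fun l y => u t y l * pderiv l (fun z => u t z j) y) (fun l => (hU l).mul (hdU j l)) γ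
    simp only at e1 e2 e3 e4 e5
    rw [e1]
    simp only
    rw [e2]
    simp only
    rw [e3]
    simp only
    rw [e4, e5]
    simp only
    have e6 : ∀ l, ipderiv γ (pderiv l (pderiv l fun z => u t z j)) x =
        pderiv l (pderiv l (ipderiv γ fun y => u t y j)) x := fun l => by
      rw [ipderiv_pderiv (hdU j l), ipderiv_pderiv (hU j)]
    simp only [e6]
  -- (A4) the pressure terms cancel
  have hA4 : ipderiv γk (pderiv i (p t)) x = ipderiv γi (pderiv k (p t)) x := by
    rw [hγk, hγi, ipderiv_cons, ipderiv_cons, ipderiv_pderiv hP, ipderiv_pderiv hP,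
      pderiv_comm (contDiff_ipderiv hP β)]
  -- `W(t)` as a function of `x`, and its derivatives
  have hWfun : ipderiv β (vortComp (u t) k i) =
      fun y => ipderiv γk (fun z => u t z i) y - ipderiv γi (fun z => u t z k) y :=
    funext (hfield t ht)
  have hdk : Differentiable ℝ (ipderiv γk fun z => u t z i) :=
    (contDiff_ipderiv (hU i) γk).differentiable (by simp)
  have hdi : Differentiable ℝ (ipderiv γi fun z => u t z k) :=
    (contDiff_ipderiv (hU k) γi).differentiable (by simp)
  have hW1 : ∀ l, pderiv l (ipderiv β (vortComp (u t) k i)) x =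
      pderiv l (ipderiv γk fun z => u t z i) x - pderiv l (ipderiv γi fun z => u t z k) x := by
    intro l
    rw [hWfun, pderiv_sub hdk hdi]
  have hW2 : ∀ l, pderiv l (pderiv l (ipderiv β (vortComp (u t) k i))) x =
      pderiv l (pderiv l (ipderiv γk fun z => u t z i)) x -
        pderiv l (pderiv l (ipderiv γi fun z => u t z k)) x := by
    intro l
    rw [hWfun, pderiv_sub hdk hdi, pderiv_sub]
    · exact (contDiff_pderiv (contDiff_ipderiv (hU i) γk) l).differentiable (by simp)
    · exact (contDiff_pderiv (contDiff_ipderiv (hU k) γi) l).differentiable (by simp)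
  -- (A5) `∂^γ ∂ₗ = ∂ₗ ∂^γ` on the velocity components
  have hA5 : ∀ (γ : Fin (n + 1) → ι) (j l : ι),
      ipderiv γ (pderiv l fun z => u t z j) x = pderiv l (ipderiv γ fun z => u t z j) x := by
    intro γ j l
    rw [ipderiv_pderiv (hU j)]
  -- (A6) assemble
  rw [hA1, hA3 γk i, hA3 γi k, hA4]
  simp only [hW1, hW2, hA5, mul_sub, Finset.sum_sub_distrib, Finset.mul_sum]
  ring

/-- A component is bounded by the full tensor: `|∇ᵃ uⱼ| ≤ |∇ᵃ u|^{1/2·2}`, i.e.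
`dnorm a uⱼ ≤ (levelSq a u)^{1/2}`. [folklore] -/
theorem dnorm_comp_le_sqrt_levelSq (v : EuclideanSpace ℝ ι → EuclideanSpace ℝ ι) (a : ℕ) (j : ι) (x : EuclideanSpace ℝ ι) :
    dnorm a (fun y => v y j) x ≤ Real.sqrt (levelSq a v x) := by
  rw [dnorm]
  exact Real.sqrt_le_sqrt (Finset.single_le_sum (f := fun j => dnormSq a (fun y => v y j) x)
    (fun _ _ => dnormSq_nonneg _ _ _) (Finset.mem_univ j))

/-- **The Leibniz remainder bound for the transport nonlinearity**: for a word `γ` of length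
`n + 1`, `|∂^γ(uⱼ ∂ⱼuᵢ) − uⱼ ∂^γ∂ⱼuᵢ| ≤ 2^{n+1} ∑_{a=1}^{n+1} |∇ᵃu| |∇^{n+2-a}u|`. [folklore] -/
theorem abs_transport_remainder_le {v : EuclideanSpace ℝ ι → EuclideanSpace ℝ ι} (hv : ContDiff ℝ ∞ v) {n : ℕ}
    (γ : Fin (n + 1) → ι) (i j : ι) (x : EuclideanSpace ℝ ι) :
    |ipderiv γ (fun y => v y j * pderiv j (fun z => v z i) y) x -
        v x j * ipderiv γ (pderiv j fun z => v z i) x| ≤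
      2 ^ (n + 1) * ∑ a ∈ Finset.Icc 1 (n + 1),
        Real.sqrt (levelSq a v x) * Real.sqrt (levelSq (n + 2 - a) v x) := by
  have hU : ∀ j, ContDiff ℝ ∞ fun y => v y j := fun j => contDiff_comp_of_contDiff hv j
  refine (abs_ipderiv_mul_sub_mul_ipderiv_le (hU j) (contDiff_pderiv (hU i) j) γ x).trans ?_
  refine mul_le_mul_of_nonneg_left (Finset.sum_le_sum fun a ha => ?_) (by positivity)
  rw [Finset.mem_Icc] at ha
  refine mul_le_mul (dnorm_comp_le_sqrt_levelSq v a j x) ?_ (dnorm_nonneg _ _ _)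
    (Real.sqrt_nonneg _)
  calc dnorm (n + 1 - a) (pderiv j fun z => v z i) x ≤ dnorm (n + 1 - a + 1) (fun z => v z i) x :=
        dnorm_pderiv_le (hU i) _ j x
    _ = dnorm (n + 2 - a) (fun z => v z i) x := by
        congr 1
        omega
    _ ≤ Real.sqrt (levelSq (n + 2 - a) v x) := dnorm_comp_le_sqrt_levelSq v _ i x

/-- **The vorticity forcing bound.** For an unforced classical solution and `W = ∂^β Ω_{ki}`,
`|β| = n`: `|∂ₜW − ν∑ⱼ∂ⱼ∂ⱼW + ∑ⱼuⱼ∂ⱼW| ≤ 2 (card ι) 2^{n+1} ∑_{a=1}^{n+1} |∇ᵃu| |∇^{n+2-a}u|`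
pointwise (all forcing terms are products `∇ᵃu ∇ᵇu` with `a + b = n + 2`, `a, b ≥ 1`). [folklore] -/
theorem IsClassicalNSSolutionOn.abs_vorticity_forcing_le (h : IsClassicalNSSolutionOn S ν 0 u p)
    (hS : UniqueDiffOn ℝ S) (hcl : S ⊆ closure (interior S)) {t : ℝ} (ht : t ∈ S) (x : EuclideanSpace ℝ ι)
    {n : ℕ} (β : Fin n → ι) (k i : ι) :
    |FluidPDE.timeDerivWithin S (fun s y => ipderiv β (vortComp (u s) k i) y) t x -
        ν * ∑ j, pderiv j (pderiv j (ipderiv β (vortComp (u t) k i))) x +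
        ∑ j, u t x j * pderiv j (ipderiv β (vortComp (u t) k i)) x| ≤
      2 * Fintype.card ι * 2 ^ (n + 1) * ∑ a ∈ Finset.Icc 1 (n + 1),
        Real.sqrt (levelSq a (u t) x) * Real.sqrt (levelSq (n + 2 - a) (u t) x) := by
  rw [h.vorticity_transport hS hcl ht x β k i, abs_neg]
  set B := ∑ a ∈ Finset.Icc 1 (n + 1),
    Real.sqrt (levelSq a (u t) x) * Real.sqrt (levelSq (n + 2 - a) (u t) x) with hB
  have hv := h.contDiff_velocity ht
  refine (Finset.abs_sum_le_sum_abs _ _).trans ?_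
  calc ∑ j, |ipderiv (Fin.cons k β : Fin (n + 1) → ι) (fun y => u t y j * pderiv j (fun z => u t z i) y) x -
            u t x j * ipderiv (Fin.cons k β : Fin (n + 1) → ι) (pderiv j fun z => u t z i) x -
          (ipderiv (Fin.cons i β : Fin (n + 1) → ι) (fun y => u t y j * pderiv j (fun z => u t z k) y) x -
            u t x j * ipderiv (Fin.cons i β : Fin (n + 1) → ι) (pderiv j fun z => u t z k) x)|
      ≤ ∑ _j : ι, (2 ^ (n + 1) * B + 2 ^ (n + 1) * B) := Finset.sum_le_sum fun j _ =>
        (abs_sub _ _).trans (add_le_add (abs_transport_remainder_le hv _ i j x)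
          (abs_transport_remainder_le hv _ k j x))
    _ = 2 * Fintype.card ι * 2 ^ (n + 1) * B := by
        rw [Finset.sum_const, Finset.card_univ, nsmul_eq_mul]
        ring

/-- **Symmetrisation of the forcing sum**: for nonnegative `ℓ` and `n ≥ 1`,
`∑_{a=1}^{n+1} ℓ_a ℓ_{n+2-a} ≤ 2 ∑_{a=1}^{n} ℓ_a ℓ_{n+2-a}` (the term `a = n + 1` equals the
term `a = 1`). [folklore] -/
theorem sum_Icc_succ_mul_le_two_mul {ℓ : ℕ → ℝ} (hℓ : ∀ a, 0 ≤ ℓ a) {n : ℕ} (hn : 1 ≤ n) :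
    ∑ a ∈ Finset.Icc 1 (n + 1), ℓ a * ℓ (n + 2 - a) ≤
      2 * ∑ a ∈ Finset.Icc 1 n, ℓ a * ℓ (n + 2 - a) := by
  rw [Finset.sum_Icc_succ_top (by omega), two_mul]
  refine add_le_add le_rfl ?_
  have h1 : ℓ (n + 1) * ℓ (n + 2 - (n + 1)) = ℓ 1 * ℓ (n + 2 - 1) := by
    rw [show n + 2 - (n + 1) = 1 by omega, show n + 2 - 1 = n + 1 by omega, mul_comm]
  rw [h1]
  exact Finset.single_le_sum (f := fun a => ℓ a * ℓ (n + 2 - a))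
    (fun a _ => mul_nonneg (hℓ _) (hℓ _)) (Finset.mem_Icc.2 ⟨le_rfl, hn⟩)

end Vorticity

end Literature.Analysis.FluidPDE

end
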